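import Summits.HodgeConjecture.HodgeConjecture.Theorems.Ring2AbelianAllAndreInvariantProjectorRational
import Summits.HodgeConjecture.HodgeConjecture.Theorems.Ring2AbelianAllAndreInvariantHodgeTypes
import Summits.HodgeConjecture.HodgeConjecture.Theorems.Ring2AbelianAllAndreFibreGysinHodgeType
import Literature.AlgebraicGeometry.HodgeTheory.HodgeTypeProjectors
import Literature.AlgebraicGeometry.HodgeTheory.ComplexGysinHodgeType
import Literature.AlgebraicGeometry.HodgeTheory.HodgeClassOfMorphismProofs
import HarnessLib

/-!
# Ring 2 · sub-cell AbelianAll (ALL ABELIAN VARIETIES), André axis, part XLVI-f — THE INVARIANT PROJECTOR IS A MORPHISM OF HODGE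
# STRUCTURES: it preserves Hodge types, so do the transports `j_s^* ∘ M₀`; hence (Voisin I, Lemma 11.41, a tree theorem) every transport is
# the action of a RATIONAL HODGE CLASS on `X_s × X_t`, and `HC(X_t × X_t) ⟹` the invariant projector is an algebraic cycle on `X_t × X_t`

HONEST FRAMING (page 1, verbatim): **research route, not a corollary; conditional on HC_CM plus one named
minimal statement.** Cell line: research route conditional on HC_CM; not a corollary; Q11.4-sentence-2
already refuted in dim ≥ 3. Nothing in this file proves a case of the Hodge conjecture or of `B(X)` for a named `X`; `HC_CM`
(`Theses.RankFourFaces.CMAbelianHodge`) does NOT occur; `HodgeConjectureFor` occurs only as a HYPOTHESIS (§4); item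
`Theses.RankFourFaces.CMToAbelian` (stmt-16267) stays OPEN; N104 untouched; no node is born (0 `def`, 0 `sorry`, no named-fact binder — the Hodge-model
facts used are the tree's PROVED `hodgePQ_independent_of_hodgeModel_holds`, `nonempty_hodgeModel_holds`, `exists_deRhamIsoFamily_holds`).
Seat `pub-hodge-ring2-ab-andre-2`, gen 38.

## Content (theorems only; standard axioms)

* §1 **`fiberGysin_mem_typePiece`**: `j_{t*}` is of bidegree `(1,1)` (`isOfHodgeType_complexGysin`); the commutation of bidegree-`(1,1)` maps
  with the type projectors is the seat's part XXIX-g `typeProj_comm_of_typeShift` (imported).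
* §2 **`typeProj_invariantProjector_comm`**, **`isOfHodgeType_invariantProjector`** — the invariant projector `P` (`P j_t^* = j_t^*`,
  `P|_{ker j_{t*}} = 0`) COMMUTES with the type projectors and PRESERVES HODGE TYPES: `j_t^* H^•(𝒳)` and `ker j_{t*}` are stable under the
  type projectors (`j_t^*` is of bidegree `(0,0)`, `j_{t*}` of bidegree `(1,1)`). **`isOfHodgeType_map_fiberι_halfInverse`**: every transport
  `j_s^* ∘ M₀` (topological half inverse `M₀`, part XLVI-d) preserves Hodge types (part XVI-f: `j_s^* W` and `j_t^* W` have the same types).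
* §3 **`exists_rational_hodgeClass_transport`** — for every member `s`: the transport `j_s^* ∘ M₀ : Hᵏ(X_t) → Hᵏ(X_s)` is `r⁻¹ • [c]_*` for a
  RATIONAL class `c ∈ H^{2d}((X_s × X_t)(ℂ))` of HODGE TYPE `(d,d)` and `r ≠ 0` — Voisin I Lemma 11.41 on the carriers (the tree's
  `exists_rational_hodgeClass_corrAction_eq_smul`, unconditional) fed by §2 and part XLVI-e.
* §4 **`exists_algebraic_invariantProjector_of_hodgeConjectureFor`** — `HodgeConjectureFor (d+d) (X_t × X_t) ⟹` the invariant projector of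
  `Hᵏ(X_t)` is an ALGEBRAIC self-correspondence of the member `X_t` (every `k ≤ 2d`): the level-0 necessary condition for β of part XL-a
  (`exists_algebraic_invariantProjector_of_betaInverse`), there marked «implied by `HC(X_t × X_t)`; NOT claimed» — now a kernel row.
  **`exists_algebraic_transport_of_hodgeConjectureFor`**: `HodgeConjectureFor (d+d) (X_s × X_t) ⟹` an algebraic transport class on `X_s × X_t`.

## Honest status

Fibre-level rows only: the Hodge conjecture for the abelian `2d`-fold `X_s × X_t` (a HYPOTHESIS) gives algebraic transport classes member by
member; to reach β / `B⋆(𝒳)` one needs them as restrictions of ONE class of `𝒳 × X_t` on uncountably many members (part XLVI-d) — part XLVI-g.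
No case of HC is proved; nothing minimal is claimed; N104 untouched. EDGE LABELS: §1–§3 K; §4 K with `HodgeConjectureFor` as hypothesis.
References: VoisinHodgeI2002 (§6.1.3 Thm. 6.18, §7.1.1, §7.3.2, §11.3.3 Lemma 11.41); DeligneHodgeII1971 (Thm. 4.1.1, Cor. 4.1.2);
VoisinHodgeII2003 (§4.3.3); Andre1996Motifs (§5.1, §6.3 Remarque 2); Tankeev2008 ((i)–(ii)).
-/

noncomputable section

set_option linter.dupNamespace false

namespace Summit.HodgeConjecture.HodgeConjecture.Ring2.AbelianAll

open CategoryTheory CategoryTheory.Limits AlgebraicGeometry MonoidalCategory CartesianMonoidalCategory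
open Literature.AlgebraicGeometry Literature.AlgebraicGeometry.Motives
open Literature.AlgebraicGeometry.HodgeTheory
open Literature.AlgebraicTopology.SingularHomology (singularCohomology cupProduct)
open Summit.HodgeConjecture.HodgeConjecture.Theorems (deg_fiberGysin_aux)

/-! ## §1 Maps of bidegree `(1,1)` and the type projectors: the tree's `typeProj_comm_of_typeShift` (part XXIX-g) -/

section Pencil

variable {𝒳 S : SchemeOver ℂ} {d : ℕ} {f : 𝒳 ⟶ S} (hf : IsCompactAbelianPencil f d)

/-- `𝐆[hf, s, k]` — `j_{s*}` for the complex orientations (display notation, as in part XL-a). [cite: FultonYoungTableaux1997, Appendix B §B.1 (5)] -/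
local notation3 (prettyPrint := false) "𝐆[" hf ", " s ", " k "]" =>
  complexGysin complexOrientationFamily (IsCompactAbelianPencil.isSmoothProjective_fiberOver hf s)
    (IsCompactAbelianPencil.isSmoothProjective_total hf) (fiberι f s) (deg_fiberGysin_aux k d)

/-- `𝐣[s, k]` — `j_s^*` as a linear map (display notation). [cite: VoisinHodgeI2002, §7.3.2] -/
local notation3 (prettyPrint := false) "𝐣[" s ", " k "]" => (complexBetti.map (fiberι f s) k).hom

/-- `𝐑₂[hf, s, t, hab]` — the action `Hᵏ(X_t) → Hᵇ(X_s)` of a class of `X_s × X_t` for the complex orientations (display notation for `corrAction`).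
[cite: VoisinHodgeII2003, proof of Thm. 10.17 (10.7)] -/
local notation3 (prettyPrint := false) "𝐑₂[" hf ", " s ", " t ", " hab "]" =>
  corrAction complexOrientationFamily (IsCompactAbelianPencil.isSmoothProjective_fiberOver hf s)
    (IsCompactAbelianPencil.isSmoothProjective_fiberOver hf t) hab

/-- **`j_{t*}` IS OF BIDEGREE `(1,1)`**: it carries the type piece `(p,q)` of `Hᵏ(X_t)` into the type piece `(p+1,q+1)` of `H^{k+2}(𝒳)` (the tree's
`isOfHodgeType_complexGysin`, with the Hodge-model facts PROVED in the tree). [cite: VoisinHodgeI2002, §7.3.2 (with Lemma 7.30)] -/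
theorem fiberGysin_mem_typePiece (t : ComplexPoints S) {k : ℕ} (At : HodgeModel d (fiberOver f t)) (AX : HodgeModel (d + 1) 𝒳)
    (pq : ↥(Finset.HasAntidiagonal.antidiagonal k)) {c : complexBetti (fiberOver f t) k} (hc : c ∈ At.typePiece k pq) :
    𝐆[hf, t, k] c ∈ AX.typePiece (k + 2) (HodgeModel.typeShift (show 2 + k = k + 2 by omega) pq) := by
  have hX := hf.isSmoothProjective_total
  have hXt := hf.isSmoothProjective_fiberOver t
  have hty : IsOfHodgeType d (fiberOver f t) k pq.1.1 pq.1.2 c := At.isOfHodgeType_of_mem_typePiece hc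
  have hG : IsOfHodgeType (d + 1) 𝒳 (k + 2) (pq.1.1 + 1) (pq.1.2 + 1) (𝐆[hf, t, k] c) :=
    isOfHodgeType_complexGysin hodgePQ_independent_of_hodgeModel_holds (fun _ _ ↦ nonempty_hodgeModel_holds)
      (fun E _ _ _ ↦ Literature.NumberTheory.Transcendental.exists_deRhamIsoFamily_holds E) complexOrientationFamily hXt hX (fiberι f t)
      (deg_fiberGysin_aux k d) (by omega) (by omega) hty
  exact AX.mem_typePiece_of_isOfHodgeType hodgePQ_independent_of_hodgeModel_holds hX (HodgeModel.typeShift (show 2 + k = k + 2 by omega) pq).2 hG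

/-! ## §2 The invariant projector commutes with the type projectors and preserves Hodge types -/

/-- **THE INVARIANT PROJECTOR COMMUTES WITH THE HODGE-TYPE PROJECTORS**: for any endomorphism `P` of `Hᵏ(X_t)` with `P j_t^* = j_t^*` and
`P|_{ker j_{t*}} = 0` and any Hodge model `A_t` of the member, `π_{(p,q)} (P x) = P (π_{(p,q)} x)`. Write `x = j_t^* V + z`: `π_{(p,q)} (j_t^* V) =
j_t^* (π_{(p,q)} V)` (`j_t^*` of bidegree `(0,0)`, part XVI-f `typeProj_map_comm`) is fixed by `P`, and `π_{(p,q)} z ∈ ker j_{t*}` because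
`j_{t*} (π_{(p,q)} z) = π_{(p+1,q+1)} (j_{t*} z) = 0` (§1). [cite: VoisinHodgeI2002, Thm. 6.18 and §7.3.2] [cite: DeligneHodgeII1971, Thm. 4.1.1 and Cor. 4.1.2] -/
theorem typeProj_invariantProjector_comm (t : ComplexPoints S) {k : ℕ} (At : HodgeModel d (fiberOver f t))
    (P : complexBetti (fiberOver f t) k →ₗ[ℂ] complexBetti (fiberOver f t) k)
    (hP : ∀ W, P (𝐣[t, k] W) = 𝐣[t, k] W) (hP0 : ∀ x, 𝐆[hf, t, k] x = 0 → P x = 0)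
    (pq : ↥(Finset.HasAntidiagonal.antidiagonal k)) (x : complexBetti (fiberOver f t) k) :
    At.typeProj k pq (P x) = P (At.typeProj k pq x) := by
  have hX := hf.isSmoothProjective_total
  have hXt := hf.isSmoothProjective_fiberOver t
  obtain ⟨AX⟩ := nonempty_hodgeModel_holds hX
  have hc := isCompl_range_ker_fiberGysin hf t k
  obtain ⟨y, z, hy, hz, rfl⟩ := (Submodule.codisjoint_iff_exists_add_eq.1 hc.codisjoint) x
  obtain ⟨V, rfl⟩ := hy
  have hz' : 𝐆[hf, t, k] z = 0 := LinearMap.mem_ker.1 hz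
  have hcomm : At.typeProj k pq (𝐣[t, k] V) = 𝐣[t, k] (AX.typeProj k pq V) := typeProj_map_comm hX hXt (fiberι f t) AX At k pq V
  have hGz : 𝐆[hf, t, k] (At.typeProj k pq z) = 0 := by
    rw [typeProj_comm_of_typeShift At AX (show 2 + k = k + 2 by omega) 𝐆[hf, t, k]
      (fun pq' c hc' ↦ fiberGysin_mem_typePiece hf t At AX pq' hc') pq z, hz', map_zero]
  rw [map_add, hP V, hP0 z hz', add_zero, map_add, map_add, hcomm, hP, hP0 _ hGz, add_zero]

/-- **THE INVARIANT PROJECTOR PRESERVES HODGE TYPES**: `x` of type `(p,q)` ⟹ `P x` of type `(p,q)` (`P` commutes with `π_{(p,q)}`, §2).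
[cite: VoisinHodgeI2002, Thm. 6.18 and §7.3.2] [cite: DeligneHodgeII1971, Thm. 4.1.1 and Cor. 4.1.2] -/
theorem isOfHodgeType_invariantProjector (t : ComplexPoints S) {k p q : ℕ}
    (P : complexBetti (fiberOver f t) k →ₗ[ℂ] complexBetti (fiberOver f t) k)
    (hP : ∀ W, P (𝐣[t, k] W) = 𝐣[t, k] W) (hP0 : ∀ x, 𝐆[hf, t, k] x = 0 → P x = 0)
    {x : complexBetti (fiberOver f t) k} (hx : IsOfHodgeType d (fiberOver f t) k p q x) : IsOfHodgeType d (fiberOver f t) k p q (P x) := by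
  have hXt := hf.isSmoothProjective_fiberOver t
  by_cases hpq : p + q = k
  · obtain ⟨At⟩ := nonempty_hodgeModel_holds hXt
    have hmem : (p, q) ∈ Finset.HasAntidiagonal.antidiagonal k := Finset.HasAntidiagonal.mem_antidiagonal.2 hpq
    have hxmem : x ∈ At.typePiece k ⟨(p, q), hmem⟩ := At.mem_typePiece_of_isOfHodgeType hodgePQ_independent_of_hodgeModel_holds hXt hmem hx
    have hcomm := typeProj_invariantProjector_comm hf t At P hP hP0 ⟨(p, q), hmem⟩ x
    rw [At.typeProj_apply_of_mem hxmem] at hcomm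
    -- `hcomm : π (P x) = P x`
    have hPmem : P x ∈ At.typePiece k ⟨(p, q), hmem⟩ := by
      have h := At.typeProj_mem k ⟨(p, q), hmem⟩ (P x)
      rwa [hcomm] at h
    have h := At.isOfHodgeType_of_mem_typePiece hPmem
    exact h
  · rw [isOfHodgeType_iff_eq_zero_of_add_ne hXt hpq] at hx ⊢
    rw [hx, map_zero]

/-- **EVERY TRANSPORT `j_s^* ∘ M₀` PRESERVES HODGE TYPES**: for a topological half inverse `M₀ : Hᵏ(X_t) → Hᵏ(𝒳)` (part XLVI-d) and any member `s`,
`x` of type `(p,q)` on `X_t` ⟹ `j_s^* (M₀ x)` of type `(p,q)` on `X_s`: `j_t^* (M₀ x) = P x` is of type `(p,q)` (§2), and `j_s^* W`, `j_t^* W` have the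
same types for every `W` (part XVI-f `isOfHodgeType_map_fiberι_iff`, the theorem of the fixed part on the carriers).
[cite: DeligneHodgeII1971, Cor. 4.1.2 and (4.1.3.1)] [cite: VoisinHodgeII2003, §4.3.3 Cor. 4.25] -/
theorem isOfHodgeType_map_fiberι_halfInverse (t s : ComplexPoints S) {k p q : ℕ}
    (M₀ : complexBetti (fiberOver f t) k →ₗ[ℂ] complexBetti 𝒳 k) (hM : ∀ W, 𝐣[t, k] (M₀ (𝐣[t, k] W)) = 𝐣[t, k] W)
    (hM0 : ∀ x, 𝐆[hf, t, k] x = 0 → 𝐣[t, k] (M₀ x) = 0)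
    {x : complexBetti (fiberOver f t) k} (hx : IsOfHodgeType d (fiberOver f t) k p q x) :
    IsOfHodgeType d (fiberOver f s) k p q (𝐣[s, k] (M₀ x)) := by
  have ht : IsOfHodgeType d (fiberOver f t) k p q (𝐣[t, k] (M₀ x)) := by
    have h := isOfHodgeType_invariantProjector hf t (𝐣[t, k] ∘ₗ M₀) (fun W ↦ hM W) (fun y hy ↦ hM0 y hy) hx
    simpa only [LinearMap.comp_apply] using h
  exact (isOfHodgeType_map_fiberι_iff hf (M₀ x) s t).1 ht

/-! ## §3 The transports are actions of rational Hodge classes on `X_s × X_t` (Voisin I, Lemma 11.41) -/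

/-- **EVERY TRANSPORT IS THE ACTION OF A RATIONAL HODGE CLASS ON `X_s × X_t`.** On a compact pencil of abelian `d`-folds, `k ≤ 2d`, a topological
half inverse `M₀` at `t` in degree `k` and ANY member `s`: there are a RATIONAL class `c ∈ H^{2d}((X_s × X_t)(ℂ); ℂ)` of HODGE TYPE `(d,d)` and
`r ≠ 0` with `[c]_* = r • (j_s^* ∘ M₀)` as maps `Hᵏ(X_t) → Hᵏ(X_s)`. Voisin I Lemma 11.41 on the carriers (the tree's UNCONDITIONAL
`exists_rational_hodgeClass_corrAction_eq_smul`), fed by: the transport preserves rational classes (part XLVI-e) and Hodge types (§2).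
At `s = t`: the invariant projector is the action of a rational Hodge class on `X_t × X_t`. [cite: VoisinHodgeI2002, §11.3.3 Thm. 11.38 and Lemma 11.41]
[cite: DeligneHodgeII1971, Thm. 4.1.1 and Cor. 4.1.2] -/
theorem exists_rational_hodgeClass_transport (t s : ComplexPoints S) {k : ℕ} (hk : k ≤ 2 * d)
    (M₀ : complexBetti (fiberOver f t) k →ₗ[ℂ] complexBetti 𝒳 k) (hM : ∀ W, 𝐣[t, k] (M₀ (𝐣[t, k] W)) = 𝐣[t, k] W)
    (hM0 : ∀ x, 𝐆[hf, t, k] x = 0 → 𝐣[t, k] (M₀ x) = 0) :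
    ∃ c : complexBetti (fiberOver f s ⊗ fiberOver f t) (2 * d),
      IsRationalClass c ∧ IsOfHodgeType (d + d) (fiberOver f s ⊗ fiberOver f t) (2 * d) d d c ∧
      ∃ r : ℂ, r ≠ 0 ∧ 𝐑₂[hf, s, t, (rfl : k + 2 * d = k + 2 * d)] c = r • (𝐣[s, k] ∘ₗ M₀) := by
  have hXt := hf.isSmoothProjective_fiberOver t
  have hXs := hf.isSmoothProjective_fiberOver s
  obtain ⟨A⟩ := nonempty_hodgeModel_holds hXs
  obtain ⟨B⟩ := nonempty_hodgeModel_holds hXt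
  have hφ : ∀ c, IsRationalClass c → IsRationalClass ((𝐣[s, k] ∘ₗ M₀) c) :=
    fun c hc ↦ isRationalClass_map_fiberι_halfInverse hf t s hk M₀ hM hM0 hc
  have hφH : ∀ (p q : ℕ), p + q = k → ∀ c, B.pullback k c ∈ B.hodgePQ k p q →
      A.pullback k ((𝐣[s, k] ∘ₗ M₀) c) ∈ A.hodgePQ k (p + 0) (q + 0) := by
    intro p q _ c hc
    obtain ⟨A', hA'⟩ := isOfHodgeType_map_fiberι_halfInverse hf t s M₀ hM hM0 (p := p) (q := q) ⟨B, hc⟩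
    exact hodgePQ_independent_of_hodgeModel_holds d (fiberOver f s) hXs A' A k p q _ hA'
  exact exists_rational_hodgeClass_corrAction_eq_smul hXs hXt A B (rfl : k + 2 * d = k + 2 * d) (Nat.add_zero d)
    (𝐣[s, k] ∘ₗ M₀) hφ hφH complexOrientationFamily

/-! ## §4 `HC(X_t × X_t)` makes the invariant projector algebraic; `HC(X_s × X_t)` makes the transport algebraic -/

/-- **`HodgeConjectureFor (X_t × X_t)` ⟹ THE INVARIANT PROJECTOR IS AN ALGEBRAIC SELF-CORRESPONDENCE OF THE MEMBER** (every `k ≤ 2d`): there is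
`P` on `Hᵏ(X_t)` induced by an algebraic cycle on `X_t × X_t` with `P j_t^* = j_t^*` and `P|_{ker j_{t*}} = 0` — the level-0 necessary condition for
β (part XL-a `exists_algebraic_invariantProjector_of_betaInverse`), now FROM the Hodge conjecture for the abelian `2d`-fold `X_t × X_t` (a
HYPOTHESIS): §3 at `s = t` with the topological half inverse of part XLVI-d gives a rational `(d,d)`-class acting as `r • P_t`.
[cite: VoisinHodgeI2002, §11.3.3 Lemma 11.41] [cite: Andre1996Motifs, §5.1 (p. 25) and §6.3 Remarque 2 (p. 33)] -/
theorem exists_algebraic_invariantProjector_of_hodgeConjectureFor (t : ComplexPoints S) {k : ℕ} (hk : k ≤ 2 * d)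
    (hHC : HodgeConjectureFor (d + d) (fiberOver f t ⊗ fiberOver f t)) :
    ∃ P : complexBetti (fiberOver f t) k →ₗ[ℂ] complexBetti (fiberOver f t) k,
      IsAlgebraicCorrespondence d d (fiberOver f t) (fiberOver f t) P ∧ (∀ W, P (𝐣[t, k] W) = 𝐣[t, k] W) ∧
      ∀ x, 𝐆[hf, t, k] x = 0 → P x = 0 := by
  have hXt := hf.isSmoothProjective_fiberOver t
  obtain ⟨M₀, hM, hM0⟩ := exists_topological_halfInverse hf t k
  obtain ⟨c, hrat, htype, r, hr0, hc⟩ := exists_rational_hodgeClass_transport hf t t hk M₀ hM hM0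
  have halg : c ∈ algebraicClasses (fiberOver f t ⊗ fiberOver f t) d := hHC.2 d c hrat htype
  refine ⟨r⁻¹ • 𝐑₂[hf, t, t, (rfl : k + 2 * d = k + 2 * d)] c,
    IsAlgebraicCorrespondence.smul hXt hXt (isAlgebraicCorrespondence_corrAction_complex hXt hXt _ (by omega) halg) r⁻¹,
    fun W ↦ ?_, fun x hx ↦ ?_⟩
  · rw [LinearMap.smul_apply, hc, LinearMap.smul_apply, smul_smul, inv_mul_cancel₀ hr0, one_smul, LinearMap.comp_apply, hM W]
  · rw [LinearMap.smul_apply, hc, LinearMap.smul_apply, smul_smul, inv_mul_cancel₀ hr0, one_smul, LinearMap.comp_apply, hM0 x hx]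

/-- **`HodgeConjectureFor (X_s × X_t)` ⟹ AN ALGEBRAIC TRANSPORT CLASS ON `X_s × X_t`**: an algebraic class `c ∈ N^d((X_s × X_t)(ℂ))` whose
correspondence `Hᵏ(X_t) → Hᵏ(X_s)` carries `j_t^* W ↦ j_s^* W` and kills `ker j_{t*}` — the off-diagonal necessary condition for β of part XLV-c,
member by member, from the Hodge conjecture for the abelian `2d`-fold `X_s × X_t` (a HYPOTHESIS).
[cite: VoisinHodgeI2002, §11.3.3 Lemma 11.41] [cite: Tankeev2008, Theorem, (i)–(ii)] -/
theorem exists_algebraic_transport_of_hodgeConjectureFor (t s : ComplexPoints S) {k : ℕ} (hk : k ≤ 2 * d)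
    (hHC : HodgeConjectureFor (d + d) (fiberOver f s ⊗ fiberOver f t)) :
    ∃ c ∈ algebraicClasses (fiberOver f s ⊗ fiberOver f t) d,
      (∀ W : complexBetti 𝒳 k, 𝐑₂[hf, s, t, (rfl : k + 2 * d = k + 2 * d)] c (𝐣[t, k] W) = 𝐣[s, k] W) ∧
      ∀ x, 𝐆[hf, t, k] x = 0 → 𝐑₂[hf, s, t, (rfl : k + 2 * d = k + 2 * d)] c x = 0 := by
  obtain ⟨M₀, hM, hM0⟩ := exists_topological_halfInverse hf t k
  obtain ⟨hMs, hM0s⟩ := map_fiberι_halfInverse_eq hf t s M₀ hM hM0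
  obtain ⟨c, hrat, htype, r, hr0, hc⟩ := exists_rational_hodgeClass_transport hf t s hk M₀ hM hM0
  have halg : c ∈ algebraicClasses (fiberOver f s ⊗ fiberOver f t) d := hHC.2 d c hrat htype
  refine ⟨r⁻¹ • c, Submodule.smul_mem _ _ halg, fun W ↦ ?_, fun x hx ↦ ?_⟩
  · rw [map_smul, LinearMap.smul_apply, hc, LinearMap.smul_apply, smul_smul, inv_mul_cancel₀ hr0, one_smul, LinearMap.comp_apply, hMs W]
  · rw [map_smul, LinearMap.smul_apply, hc, LinearMap.smul_apply, smul_smul, inv_mul_cancel₀ hr0, one_smul, LinearMap.comp_apply, hM0s x hx]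

end Pencil

end Summit.HodgeConjecture.HodgeConjecture.Ring2.AbelianAll

end
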